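import Mathlib
import HarnessLib
import HarnessLib.Audit
import Summits.QuantumFields.Statement

/-!
Route: SeaNonGibbs

DORMANT since 2026-09-03T09:42:06Z (reconciler: no traction for 5 d (last activity statement-checked at 2026-08-29T08:46:06Z); parked, not closed — `ledger route dormant route-QuantumFields-SeaNonGibbs --off` to reactivate) — unstaffed, not closed; items shared with open routes are served there. `ledger route dormant <id> --off` reactivates.

# Route SeaNonGibbs — the sea is not a potential — the unquenched Wilson gauge marginal is uniformly
Gibbsian iff κ < 1/8, non-quasilocal at the cutoff throughout 1/8 < κ < 1/4, and quasilocal again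
after one block step

DESIGN-RULE ROUTE WITH A DECIDING POSITIVE TWIN, realising card the-sea-is-not-a-potential (spine).
Object: the unquenched gauge marginal of the statement's
own regularisation — `qcdLatticeMeasure L β m` = Z⁻¹ e^{−βS_W} ∏_f |det D_W(U, m_f, 1)| dU on the
SU(3) four-torus (N_f degenerate
Wilson flavours, r = 1, κ = 1/(2m+8)) — and its infinite-volume limit points ("sea states") on
`LGConfig 4 SU3`. It suffices to show
X := QuasilocalAfterBlocking ∧ SeaThreshold ∧ ChiralCompletion — the card's POSITIVE TWIN made the
deciding chain (D-0027 §2.1: `closes :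
QuasilocalAfterBlocking → SeaThreshold → ChiralCompletion → QCD`, pure logic): (c)
QuasilocalAfterBlocking — the image of every
infinite-volume sea state (β ≥ 0, m ∈ (−2,0), N_f ≥ 1) under one axial block-averaging step
`axialBlockHolonomy M`, M ≥ 2, IS a quasilocal
measure (blocking smears the pinned eigenvalue); (d) SeaThreshold := QuasilocalAfterBlocking →
threshold-form QCD — the QCD-complete ENGINE item
(flagged, rank 6): a DEFECT-ROBUST Yang–Mills engine acting on the blocked, quasilocal sea (card K3
RobustnessWithDefects + the bridge cards'
cruxes; to be split in tenure) constructs, for N_f = 2 and 3, one mass-independent regularisation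
with leading-log mass scaling and some
offset M₀ ≥ 0 above which every mass tuple carries OS data with `IsQCDAlong`, non-trivial
non-Gaussian glue, dynamical quarks and one gap Δ of
the continuum AND the lattice Hamiltonian (the threshold form, shared verbatim with
HeavyThresholdYMBridge's target ThresholdQCD); (e)
ChiralCompletion — threshold form ⇒ the re-typed `QCDOf N_f` (statement re-type 2026-08-16, p117723:
`∃ reg, HasMassScaling ∧ IsChiralAtZero
∧ ∀ m > 0, …`): re-pin m_crit(k) to the chiral critical line κ_c(β_k) of Wilson fermions — for this
route INSIDE the non-quasilocal window —,
extend data and gap to every positive tuple, and deliver `reg.IsChiralAtZero` (the flavoured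
pseudoscalar lattice gap tends to 0 as m → 0⁺,
continuum limit first; Goldstone/GMOR). (e) is the SHARED chiral item of the QCD pool
(stmt-QuantumFields-17394, asked verbatim by
QuarksAsStableAction); (d) + (e) are the two-regime re-cut, at the re-type, of the former programme
item SeaProgramme := QuasilocalAfterBlocking
→ QCD (revs 1–5, dropped; it follows back from (d), (e) by `fun hS hC hQ => closes hQ hS hC`,
Sketch.lean). The route's DISTINCTIVE content — what makes this line necessary rather than optional,
filed as ranked cruxes OUTSIDE the
deciding chain (refutation/calibration rungs, as HeavyThresholdYMBridge does) — is the barrier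
theorem "the sea is not a potential":
(a) UniformLoopPotential (support) — for m > 0 (κ < 1/8) the conditional single-link laws of
`qcdLatticeMeasure` depend on links at
ℓ¹-distance L only through O((8κ)^{2L}), uniformly in β, volume and gauge field (the sea IS a
uniformly convergent loop potential);
(b₀) RealModesFillTheWindow — for every m ∈ (−2, 0) (1/8 < κ < 1/4) gauge fields with Re det
D_W(U,m,1) < 0 (an odd number of real
modes of the Wilson operator below −m: quenched zero modes) exist on all large tori; (b₁)
NonQuasilocalWindow — for N_f ≥ 1 and
m ∈ (−2,0) the conditional single-link laws of two configurations agreeing on a ball of ANY radius L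
can differ by ≥ δ(N_f, β, m) > 0
in total variation on all large tori: the cutoff sea is NOT "Yang–Mills + a uniformly convergent
quasilocal potential" — the DESIGN RULE
that voids every sup-small-sea hypothesis in the QCD pool (heavy-threshold, quarks-as-stable-action,
adaptive-coarse-space, multiboson
bridges) inside the window every light-quark witness of `QCDOf` enters (m_crit(k) < 0 ⇔ κ > 1/8 —
since the re-type m_crit(k) is by `IsChiralAtZero`
the chiral critical line itself, K_cr(π) = 1/4 at β = 0 and ⅛(1 + 0.651/β + …) perturbatively,
MontvayMunster1994 pp. 233, 239 (5.62) —
while `IsQCDAlong` keeps m_f(k) > −1);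
(b₂) NonQuasilocalSeaStates — every infinite-volume sea state at β ≥ 0, m ∈ (−2,0) is consistent
with NO quasilocal (Feller)
specification (`NonGibbs.IsQuasilocalMeasure`, van Enter–Fernández–Sokal Def. 2.13 as proved-in-tree
vocabulary): non-Gibbsian for every
continuous absolutely summable potential. (b₁)/(b₂) decide between this route and its sup-small
rivals; (c) is load-bearing for `closes`.
Lean: `QuasilocalAfterBlocking ∧ SeaThreshold ∧ ChiralCompletion`

## Assembly
Pure logic (Sketch.lean `closes'` / `assembly'_holds`, rc 0, axioms propext / Classical.choice /
Quot.sound):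
`fun hQ hS hC => ⟨hC 2 (Or.inl rfl) (hS hQ 2 (Or.inl rfl)), hC 3 (Or.inr rfl) (hS hQ 3 (Or.inr
rfl))⟩` — `QCD` unfolds to `QCDOf 2 ∧ QCDOf 3`, the
engine's threshold form at N_f = 2, 3 is fed to the chiral completion. The deciding chain is the
positive twin: QuasilocalAfterBlocking
(structural input this route CAN deliver) → SeaThreshold (the QCD-complete engine + bridge, flagged)
→ ChiralCompletion (the re-type delta,
shared) → QCD. The barrier items (RealModesFillTheWindow, NonQuasilocalWindow,
NonQuasilocalSeaStates; support UniformLoopPotential,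
SeaStatesExist) are deliberately OUTSIDE the chain: a negative theorem cannot help prove QCD, but it
decides WHICH positive chain is available —
if (b₁) holds, every route assuming a sup-small quasilocal sea is vacuous and the defect form of
SeaThreshold is forced; if (b₁) is refuted,
this route is superseded by the cheaper sup-robust bridges. They are also Literature-grade
deliverables (candidate barrier-catalogue entry
"SeaNonGibbs").

Rationale: WHY THIS LINE. Transplant of van Enter–Fernández–Sokal non-Gibbsianness (VanenterFernandezSokal1993
§4, Fernandez2000Gibbsianness) with an explicit
dictionary: hidden spins summed out ↦ Wilson quarks Berezin-integrated out; bad visible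
configuration ↦ a gauge field on which
D_W + m has an exact simple real eigenvalue at 0 (a quenched zero mode, EdwardsHellerNarayanan1998
region II, BerrutoNarayananNeuberger2000
exact local modes); Griffiths carriers ↦ dislocations / small instantons; the O(1) essential
discontinuity comes from the CANCELLATION of
the exponentially small eigenvalue shift in the normalised conditional law
(|δλ(u)|^{N_f}/E|δλ|^{N_f}), so no Peierls or Pirogov–Sinai
input is needed — the QCD instance is easier than the Ising one. Imported areas: rigorous
statistical mechanics of non-Gibbsian
measures (the tree's PROVED `PositionSpaceRGNonGibbsian`, VEFS Thm 4.2, supplies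
`IsQuasilocalMeasure` on `ZdEdge 4 → SU3`),
spectral flow / index theory of the Wilson operator (EdwardsHellerNarayananInstanton1998, Adams2001,
Luscher1982Topology), and the
tree's proved `HoppingExpansionLocality` (the ℓ² disc ‖κM[U]‖ ≤ 8κ < 1 is exactly regime (a)). What
it does that nothing in the
pool or the literature does: a specification-level theorem with the sharp threshold κ = 1/8 for a
gauge marginal obtained by
integrating lattice fermions, a deterministic finite-volume form usable as a design rule, and the
blocking-restoration twin
(BricmontKupiainenLefevere1998, MaesRedigVanmoffaert1999 template) — there are no QCD routes and no
refuted statements to steer around.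

RANKED CRUXES. #2 NonQuasilocalSeaStates (crux) — for every N_f ≥ 1, β ≥ 0 and m ∈ (−2, 0): every
probability measure μ on `LGConfig 4 SU3` that is the limit, on bounded continuous cylinder
observables, of the periodic lifts of `qcdLatticeMeasure (L_k+1) β (m,…,m)` along a strictly
increasing sequence of torus sides (an infinite-volume sea state) is NOT a quasilocal measure: it is
consistent with no Feller specification
(`Literature.Barriers.CriticalPhenomena.NonGibbs.IsQuasilocalMeasure`, VEFS Def. 2.13/2.14), hence
is the Gibbs measure of no continuous absolutely summable potential. Proof shape (card (b)):
essential discontinuity at η* = (rough typical far field) + (one dislocation at distance L pinning a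
simple real mode of D_W + m at 0); tuned exteriors give the single-link law ∝ |δλ(u)|^{N_f} ×
smooth, detuned ones the smooth law; both classes charge every neighbourhood of η*. [deps:
NonQuasilocalWindow, RealModesFillTheWindow] [difficulty: XL] (why it might fail: conditional
expectations of LIMIT states must be limits of the torus kernels on positive-measure tuned/detuned
events through a typical rough far field: needs a.s. decay of the supercritical Wilson propagator
(open) and a Wegner-type bound so far resonances cannot mask the carrier.)
[VanenterFernandezSokal1993, Fernandez2000Gibbsianness, BerrutoNarayananNeuberger2000,
EdwardsHellerNarayanan1998, Georgii2011, Kulske2003]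
#3 QuasilocalAfterBlocking (crux) — for every N_f ≥ 1, β ≥ 0, m ∈ (−2, 0) and block size M ≥ 2: the
push-forward of every infinite-volume sea state (same hypotheses as in NonQuasilocalSeaStates) under
Bałaban's axial block-link map `axialBlockHolonomy M` IS a quasilocal measure (consistent with some
Feller specification). Card (c): integrating the fine fluctuations compatible with the block links
smears the pinned eigenvalue over a width w(V) > 0, so the interior distortion becomes O(e^{−2cL}/w)
and dies with the distance; the design-rule residue (the block potential is quasilocal but NOT
sup-small near mode-pinning block patterns) is recorded in Not decomposed yet. [deps:
NonQuasilocalSeaStates] [difficulty: XL] (why it might fail: needs a uniform lower bound on the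
fibre-smearing width of a pinned real mode under the block constraint (non-degenerate dependence on
the free fine links for EVERY block field) and decay of fibre-averaged quark-loop influence between
blocks; inside an Aoki phase (gapless γ₅D_W) both are doubtful.) [BricmontKupiainenLefevere1998,
MaesRedigVanmoffaert1999, Fernandez2000Gibbsianness, HallerKennedy1996, Balaban1985UV3,
SharpeSingleton1998]
#4 NonQuasilocalWindow (crux) — (design rule, deterministic, finite volume) for every N_f ≥ 1, every
real β and every m ∈ (−2,0) there is δ > 0 such that for every radius L, on all sufficiently large
tori (side n+1, n ≥ n₀(L)), there are a link e₀ and two SU(3) gauge fields U, U′ agreeing on every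
link whose base point is within ℓ¹ torus distance L of e₀'s (other than e₀) whose conditional
single-link laws at e₀ — densities p(U,e₀,u) = w(U[e₀:=u]) / ∫ w(U[e₀:=v]) dv w.r.t. Haar, w =
e^{−βS_W}|det D_W(·,m,1)|^{N_f} the `qcdLatticeMeasure` weight, both normalisers positive — are at
total-variation distance ≥ δ. So no version of the sea's conditional probabilities is quasilocal
UNIFORMLY in the volume; equivalently the cutoff sea is not "Yang–Mills + a uniformly convergent
quasilocal potential" for any κ ∈ (1/8, 1/4). Construction: U = free links + one dislocation at
distance L+1 tuned (IVT from RealModesFillTheWindow) to a simple real mode of D_W+m at 0 with the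
zero placed at the action-minimising u; U′ = the same with the dislocation detuned. [deps:
RealModesFillTheWindow] [difficulty: L] (why it might fail: the tuned real mode must be SIMPLE with
first-order shift non-constant on the window link uniformly in L; a forced eigenvalue collision at
−m along every dislocation family, or carriers whose modes are compactly supported and blind to all
far links (BNN-type exact local modes), would shrink δ to 0.) [BerrutoNarayananNeuberger2000,
EdwardsHellerNarayanan1998, VanenterFernandezSokal1993, Neuberger2000, MontvayMunster1994]
#5 RealModesFillTheWindow (crux) — quenched zero modes occur throughout the supercritical window:
for every m ∈ (−2, 0) there is n₀ such that on every four-torus of side n+1 ≥ n₀+1 some SU(3) gauge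
field U has Re det D_W(U, m, 1) < 0 — by the tree's `WilsonDeterminantSign` an odd spectral index,
i.e. an odd number of real eigenvalues of the Wilson operator below −m; by
`WilsonDeterminantMassSplitting`-style IVT along any path from U = 1 this yields fields with a real
mode EXACTLY at −m (the bad configurations of cruxes 2 and 4). Edwards–Heller–Narayanan's region II
made a theorem: carriers are smooth instanton transcripts for −m → 0⁺ (index theorem at small
spacing) and hypercube dislocations for −m → 2⁻ (BNN: U(1) hypercube modes for m < −1.7, SU(2) for m
< −1.1). [difficulty: M] (why it might fail: carriers for −m → 0⁺ must grow (size ≍ |m|^{-1/2};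
needs the lattice index theorem for transcripts of smooth charge-1 fields plus location of the
crossing), for −m → 2⁻ they are rough dislocations; an odd count below −m could fail on some middle
sub-window on every volume.) [EdwardsHellerNarayanan1998, EdwardsHellerNarayananInstanton1998,
BerrutoNarayananNeuberger2000, Adams2001, Luscher1982Topology, MohlerSchaefer2020]
#6 SeaThreshold (crux) — ENGINE ITEM (QCD-complete, flagged): QuasilocalAfterBlocking →
threshold-form QCD for N_f ∈ {2,3} (∃ M₀ ≥ 0, ∃ reg with HasMassScaling, ∀ tuples above M₀: z,
shift, OS data T with IsQCDAlong, non-trivial non-Gaussian glue, dynamical quarks, ∃ Δ > 0 with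
T.HasMassGap Δ ∧ HasLatticeMassGap Δ — the body of HeavyThresholdYMBridge's ThresholdQCD, verbatim):
given that one block step turns the Wilson sea into a quasilocal block potential (quasilocal but NOT
sup-small near mode-pinning block patterns: a dilute, for odd N_f signed, defect layer INSIDE
Bałaban's small-field region), a DEFECT-ROBUST SU(3) Yang–Mills engine (lattice gap + sequential OS
limit stable under perturbations analytic and small on small-field block configurations except on
defects with activities ≤ a_k^p per physical volume — card K3 RobustnessWithDefects, the corrected
form of the bridge cards' RobustYM hypotheses), fed with the blocked sea along an asymptotically
scaling scheme with bare masses on the line of constant physics, quark channels inheriting the gap,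
yields massive QCD above some offset. Weaker than the dropped SeaProgramme (Sketch.lean
`seaThreshold_of_seaProgramme`). Not for provers now; typed so the route decides the statement and
so refuters can sharpen the engine's hypothesis; foreseen split DefectRobustYM → SeaAdmissible →
FermionicInheritance. [deps: QuasilocalAfterBlocking] [difficulty: open-problem] (why it might fail:
QCD-complete: (c) is qualitative (fixed β, m; no rates, no uniformity along β → ∞ / the LCP); needs
a robust SU(3) Yang–Mills gap + OS-limit engine of DEFECT type (none exists even for N_f = 0),
κ-tuning inside the non-quasilocal window, signed defect activities for odd N_f, gap inheritance by
quark channels.) [JaffeWitten2000, Balaban1989LargeFieldII, Balaban1988Convergent,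
BricmontKupiainenLefevere1998, ScottSokal2005, MontvayMunster1994]
#7 ChiralCompletion (crux) — THE RE-TYPE DELTA, SHARED (stmt-QuantumFields-17394, verbatim; wanted
with QuarksAsStableAction, re-askable by the whole heavy-threshold family): for N_f ∈ {2,3},
threshold form ⇒ `QCDOf N_f` as re-typed on 2026-08-16 (p117723) — ONE mass-scaling regularisation
whose m_crit(k) is pinned to the chiral critical line κ_c(β_k) of Wilson fermions (no hidden offset;
for this route INSIDE the window κ > 1/8), OS data + IsQCDAlong + non-triviality + T.HasMassGap Δ ∧
HasLatticeMassGap Δ at EVERY positive tuple (arbitrarily light quarks), AND `reg.IsChiralAtZero`: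
for every ε > 0 some positive tuple has no uniform lattice gap ε — the gap closes as m → 0⁺
(continuum limit first, eventually in k; Goldstone pions m_π² ≍ B·m if chiral symmetry breaks, 't
Hooft anomaly matching otherwise). Consumption lemma landed: `isChiralAtZero_of_goldstone`
(Theorems/QuarksAsStableActionStableActionBridgeChiralCriterion.lean: a connected pseudoscalar
two-point LOWER bound ≥ c·e^{−μ a_k n_k}, μ < ε, along a_k n_k → ∞ refutes HasLatticeMassGap ε).
[deps: SeaThreshold] [difficulty: open-problem] (why it might fail: contains light-quark lattice QCD
— m_crit(k) tuned to κ_c(β_k) beyond the O(aΛ) ambiguity, UV/IR control of arbitrarily light Wilson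
quarks (near-real modes of D_W: this route's own window; Aoki/first-order dichotomy at fixed a),
gaplessness of massless N_f = 2, 3 QCD — none has an OS-level proof.) [GellmannOakesRenner1968,
GasserLeutwyler1984, tHooft1980Naturalness, SharpeSingleton1998, Aoki1984WilsonPhase,
EdwardsHellerNarayanan1998, tree:Literature.Barriers.QuantumFields.AokiPhaseDichotomy]
#9 UniformLoopPotential (support) — regime (a), κ < 1/8: for every m > 0 and N_f there is C such
that for every real β, every torus, every link e₀, every radius L and every two gauge fields
agreeing on the links within ℓ¹ distance L of e₀ (other than e₀), the conditional single-link laws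
at e₀ (as in NonQuasilocalWindow) are within C·(4/(m+4))^{2L} in total variation — θ = 4/(m+4) = 8κ.
Proof: log|det(1−κM)| ratio = log|det₂₄(1 − κ B R_η^{loc})| with R = (1−κM)^{-1}, ‖κM[U]‖₂ ≤ 8κ = θ
< 1 (each direction's hop pair is 2 × a unitary), and ‖P_S(R_η − R_η′)P_S‖ ≤ 2θ·θ^{2L−2}/(1−θ)² by
the range-one locality of the tree's `HoppingExpansionLocality` (`pow_apply_eq_zero_of_lt`,
`norm_inv_le`); the plaquette factor through e₀ cancels for L ≥ 1. [difficulty: provable-now]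
[SeilerLNP1982, Rothe2005, MontvayMunster1994,
Literature.Barriers.QuantumFields.HoppingExpansionLocality]
#9 SeaStatesExist (support) — non-vacuity of cruxes 2–3: for every N_f, β, m there are a probability
measure μ on `LGConfig 4 SU3` and a strictly increasing sequence of torus sides along which the
periodic lifts of `qcdLatticeMeasure (L_k+1) β (m,…,m)` converge to μ on bounded continuous cylinder
observables (compactness of SU(3)^{edges}, diagonal argument over a countable dense family of
cylinder functions; `qcdLatticeMeasure` is a probability measure for every side ≥ 1 since the weight
is continuous, non-negative and not identically zero). [difficulty: provable-now] [Georgii2011,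
FriedliVelenik2017, OsterwalderSeiler1978]

TWO-LAYER PLAN. Foreseen glued splits (k ≤ 3, depth 1), filed only after a crux closes:
RealModesFillTheWindow ⇐ SmallMassCarriers (m ∈ (−1−c, 0):
abelian/SU(2) instanton transcripts of growing size, Adams2001 index at small spacing + location of
the crossing) → DislocationCarriers
(m ∈ (−2, −1+c): a certified one-parameter hypercube family after BNN, interval arithmetic on det
R_S) → RealModesFillTheWindow.
NonQuasilocalWindow ⇐ TunedCarrier (simple real mode exactly at −m, non-degenerate coupling to a
link at distance L, zero placed at the
action minimiser) → NormalisationCancellation (finite-dimensional eigenvalue perturbation +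
free-propagator decay from the hole lemma
|W(p)+m|² ≥ (W+m)² + W(2−W) + compactness ⇒ δ) → NonQuasilocalWindow. NonQuasilocalSeaStates ⇐
LimitKernels (conditional expectations of
sea states are limits of torus kernels on good far fields) → TunedEventsCharged (tuned/detuned ×
good-far-field events have positive
μ-measure; r²-suppression of exact resonances by the sea weight itself) → NonQuasilocalSeaStates.
QuasilocalAfterBlocking ⇐
FibreSmearing (w(V) ≥ w₀ > 0 uniformly in the block field) → BlockInfluenceDecay →
QuasilocalAfterBlocking. SeaThreshold ⇐ DefectRobustYM
(card K3: sup-robust ⇒ defect-robust SU(3) Yang–Mills by a convergent, possibly signed,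
defect-polymer resummation; shared with the
bridge routes' RobustYM / YMLatticeGapAlongAFSequences hypotheses) → SeaAdmissible (the blocked sea
with its defect layer is an admissible
perturbation uniformly along an AF scheme above a mass offset; rate form of (c), card K2) →
FermionicInheritance (quark channels, `IsQCDAlong`
clauses, non-decoupling) → SeaThreshold. ChiralCompletion ⇐ ChiralLineLocation (m_crit(k) = κ_c(β_k)
to o(a_k/Z_m(k)), inside the window) →
LightQuarkBody (data + gap at every positive tuple) → GoldstoneGaplessness (`IsChiralAtZero` via
`isChiralAtZero_of_goldstone`: continuum limit
first, then m → 0⁺, so GMOR m_π² ∝ m suffices and BOTH Sharpe–Singleton scenarios are compatible —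
Aoki width ∼ a³, scenario-(2) pion mass ∼ a,
tree barrier AokiPhaseDichotomy `evasions_known`) → ChiralCompletion; shared, to be split by
whichever wanting route's tenure reaches it first.

KILL CRITERIA. QuasilocalAfterBlocking refuted (a blocked sea state that is still non-quasilocal):
the deciding chain dies — close
`refuted:QuasilocalAfterBlocking`, hand the barrier items to the negatives index / barrier catalogue
and to a successor route with a
multi-step or defect-carrying blocking. NonQuasilocalWindow refuted at some (β, m) in the window
(conditional laws uniformly quasilocal
there): the thesis "the sea is not a potential" dies and with it the necessity of the defect form —
close `superseded --by` the cheapest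
sup-robust bridge (route-QuantumFields-HeavyThresholdYMBridge). RealModesFillTheWindow refuted on a
sub-window [a, b] ⊂ (−2, 0): restate
the window items on (−2,0)∖[a,b] (pivot; supersede only if [a,b] ⊇ (−1, 0), the range `IsQCDAlong`
allows). NonQuasilocalSeaStates refuted
while the window crux stands (almost-sure quasilocality despite sup-norm failure): restate rank 2 as
the weak-Gibbs dichotomy
(Dobrushin–Shlosman / Maes–Redig–Van Moffaert form); design rule and deciding chain survive.
SeaThreshold refuted (¬threshold-QCD given (c))
would refute QCD outright given (c) — a summit-level event; ChiralCompletion refuted (massive QCD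
above a threshold exists but the re-typed
`QCDOf` fails: no Wilson regularisation is chiral at zero, or light quarks admit no gap) would
refute `QCD` as typed for EVERY route of the
pool while certifying massive QCD — a statement-level event to report (needs-human), not a pivot of
this line. A proof of QCD elsewhere moots
SeaThreshold and ChiralCompletion but not the barrier items.

NOT DECOMPOSED YET. Deliberately not items at open: the no-Poincaré/no-spectral-gap corollary of
RealModesFillTheWindow for `qcdLatticeMeasure` at fixed
volume (card P2: det² vanishes quadratically across a separating wall, collar test functions; serves
the YangMills-sub detector cards);
the children of SeaThreshold (DefectRobustYM = card K3 "sup-robust ⇒ defect-robust Yang–Mills",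
SeaAdmissible, FermionicInheritance) and of
ChiralCompletion (ChiralLineLocation, LightQuarkBody, GoldstoneGaplessness) —
layer-2, filed only when (c) or a bridge route's RobustYM item moves; DefectRobustYM is meant to be
SHARED by signature with
route-QuantumFields-HeavyThresholdYMBridge / HeavyThresholdBridge once their robust-YM hypotheses
are restated in defect form); the quantitative rate of (c) (card K2: decay
e^{−c·min(a_k m, d(m))R}, prefactor (ℓ/a)⁴/g_ℓ², defect probability per block) and Bałaban's
gauge-COVARIANT averaging instead of the axial
map; split (non-degenerate) masses and the signed odd-N_f weight (items use `qcdLatticeMeasure`'s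
|det|^{N_f}); the window m ≤ −2
(κ ≥ 1/4, between higher doublers); constants δ(N_f, β, m), n₀(L).

CHEAPEST FALSIFIER. Kit-sized, not run here (compute-free hub, plancard seat): exact diagonalisation
of the 12·6⁴-dimensional Wilson operator for (i) the
BNN SU(2)⊂SU(3) hypercube family and (ii) lattice transcripts of one instanton of size ρ = 1…3 on
6⁴–8⁴: does ONE simple real eigenvalue
sweep (0, 2) continuously as the family parameter runs (RealModesFillTheWindow for all m at once),
and is the first-order shift
ψ₀†(x)(1∓γ_μ)U ψ₀(x±μ̂) on a link at distance 3 non-zero (12 components; NonQuasilocalWindow's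
non-degeneracy)? A family on which real
modes provably avoid a sub-window of (0,2) on every volume, or a vanishing shift, retires the
corresponding crux. Lookup already done:
no specification-level statement about fermion-induced gauge measures found (galaxy --star all
"non-Gibbsian", crossref ×2, the card's
crossref ×4 / galaxy / frontier).

NUMBERS. κ = 1/(2m+8): window m ∈ (−2, 0) ⇔ κ ∈ (1/8, 1/4); θ = 8κ = 4/(m+4) < 1 ⇔ m > 0 (‖M[U]‖₂ ≤
8, Rothe2005 p. 163 after SeilerLNP1982);
free gap d(m) = min(|m|, 2−|m|) = decay rate of BNN's exact local modes ("distance of m from the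
nearest even non-negative integer",
BerrutoNarayananNeuberger2000 §7); BNN §4, §6 (d = 4): fluxon first zero at m = −2.880, U(1)
hypercube modes for m < −1.7, SU(2)
hypercube for m < −1.1, none found from 5-site clusters above −2.5; EHN (EdwardsHellerNarayanan1998
§1–2): region II from m₁(β=5.7) =
1.02 up to 2, m₁ decreasing with β, m_c > m₁; K_cr(β=0) = 1/4 and K_cr = ⅛(1 + 0.651/β + …)
(MontvayMunster1994 §5.1.4, (5.62));
MohlerSchaefer2020 §4.2: negative strange determinants on ≈2% (β=3.4) … 0.05% (β=3.7) of CLS N_f =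
2+1 configurations — carriers occur
at physical parameters. Items: 9 (assembly, 5 cruxes — the flagged engine item SeaThreshold and the
shared ChiralCompletion replacing SeaProgramme at the 2026-08-16
re-type —, 3 supports; RealModesFillTheWindow re-badged support at the 2026-08-15 retriage). Chiral
line (re-type 2026-08-16): `IsChiralAtZero` makes m_crit(k) the chiral critical bare mass at β_k;
K_cr(π) = 1/4 at β = 0 (MontvayMunster1994 p. 233) and K_cr = ⅛(1 + g²·0.1085 + …) = ⅛(1 + 0.651/β +
…) > ⅛ perturbatively (ibid.
p. 239, (5.62); their β = 6/g²), i.e. m_c(β) < 0: in the window; for κ ≤ ⅛ − δ quark lines decay at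
lattice rate ≥ −log(1 − 8δ)
uniformly in U (regime (a), ‖κM[U]‖₂ ≤ 8κ).

DEFINITION REQUESTS. None needed to type the items (all nine elaborate; Sketch.lean rc 0 incl. the
2026-08-16 re-cut): `qcdLatticeMeasure`, `LGConfig`, `torusLift`, `IsCylinder`,
`axialBlockHolonomy`, `NonGibbs.IsQuasilocalMeasure`, `wilsonDirac`, `fermionDet`, `haarProbability`
exist. Convenience notions a grounder
may want later (not filed): `qcdSeaStates β m Nf : Set (Measure (LGConfig 4 SU3))` (the limit-point
set spelled out inline in cruxes 2, 3
and SeaStatesExist) and `seaLinkLaw` (the conditional single-link density spelled out by `let` in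
crux 4 / UniformLoopPotential).

Novelty: Searches (2026-08-15, this seat): `lit galaxy search "non-Gibbsian" --star all` (37 rows: Külske
WIAS-781 joint measures, Lőrinczi–Maes
weakly Gibbs JSP 89, van Enter–Le Ny Dyson decimation, van Enter–Ermolaev–Iacobelli–Külske trees —
no gauge fields, no determinants);
`lit search --source crossref "real eigenvalues Wilson Dirac operator spectral flow dislocations
zero modes"` (15: Fujiwara 2002
doi:10.1142/9789812776358_0011 abelian spectral flow, Bergner–Wuilloud 2012
doi:10.1016/j.cpc.2011.10.007 numerics of real eigenvalues);
`lit search --source crossref "Berruto Narayanan Neuberger exact local fermionic zero modes"` →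
doi:10.1016/s0370-2693(00)00905-9 READ in
full (arXiv:hep-lat/0006030); `lit search --hybrid` unavailable (searchd rc 75, twice), arXiv API
429; `ledger negatives --problem
QuantumFields` (0); plus the card's own crossref ×4, galaxy --star all and `lit frontier
QuantumFields --since 2021` (no hit), confirmed
by the refuter novelty audit of 12:51Z. In-tree:
`Literature.Barriers.CriticalPhenomena.PositionSpaceRGNonGibbsian` (VEFS Thm 4.2 proved)
— vocabulary reused, different hidden mechanism.
Nearest prior art found: VanenterFernandezSokal1993 (the mechanism, spin decimations; Thms 4.1–4.3),
BerrutoNarayananNeuberger2000 (the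
carriers: finite density of exact local Wilson zero modes, with the remark that quenched artefact
modes "cannot be helpful to the hope of
recovering a limit that can be described by a local effective Lagrangian" — quenched, no specific  [refs: 10.1142/9789812776358_0011, 10.1016/j.cpc.2011.10.007, 10.1016/s0370-2693(00, hep-lat/0006030, doi:10.1142/9789812776358_0011, doi:10.1016/j.cpc.2011.10.007, doi:10.1016/s0370-2693, VanenterFernandezSokal1993, BerrutoNarayananNeuberger2000, Kulske2003, EdwardsHellerNarayanan1998]

Barriers (technique_class: non-gibbsian-measure, essential-discontinuity, design-rule): - technique_class: non-gibbsian-measure, essential-discontinuity, design-rule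
- Literature.Barriers.QuantumFields.HoppingExpansionLocality: not evaded but USED — its ℓ² disc
‖κM[U]‖₂ ≤ 8κ < 1 is regime (a) (UniformLoopPotential reuses `pow_apply_eq_zero_of_lt`,
`norm_inv_le`); the route shows the disc is sharp for quasilocality of the marginal, a stronger
statement than divergence of the Neumann series.
- Literature.Barriers.QuantumFields.WilsonDeterminantSign: the mechanism, not an obstacle — Re det
D_W < 0 ⇔ odd index is what RealModesFillTheWindow asserts to be inhabited throughout the window; no
positivity is claimed (items use |det|^{N_f}).
- Literature.Barriers.QuantumFields.WilsonDeterminantMassSplitting: used — its intermediate-value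
argument turns det < 0 into an exact real mode at −m (the bad configurations of cruxes 2 and 4).
- Literature.Barriers.QuantumFields.BanksCasherCriterion: consistent — no spectral gap of D_W or of
γ₅D_W is claimed; the line exploits its absence.
- Literature.Barriers.QuantumFields.VafaWittenEigenvalueBound: consistent — only existence of real
modes below −m is used, no uniform eigenvalue bound in the flavour-singlet sense is contradicted.
- Literature.Barriers.QuantumFields.AokiPhaseDichotomy: consistent for (b₀)–(b₂), which hold across
the whole window wherever κ_c(β) lies; it is the named risk of QuasilocalAfterBlocking (gapless
γ₅D_W inside an Aoki phase), recorded in that crux's why-line. Since the 2026-08-16 re-cut it also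
bears on C

History (route lifecycle, newest last):
- 2026-08-15T13:51:21Z · rev 1: restated Assembly (stmt-QuantumFields-8860) — D-0027 §2.1 conformance (the 13:36Z audit retires routes whose assembly does not conclude the sub Statement): deciding chain = positive twin QuasilocalAfterBloc (planner-plancard-QuantumFields-QCD-the-sea-is-0e653be0-0)
- 2026-08-16T23:24:20Z · rev 6: restated Assembly (stmt-QuantumFields-9155) — route-repair (statement-revised p117723: QCDOf gains reg.IsChiralAtZero) — supply the conjunct as an explicit SHARED crux: two-regime re-cut of the programme it (planner-rrepair-QuantumFields-SeaNonGibbs-stmt-d92b31b0-0)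
- 2026-08-16T23:24:20Z · rev 6: dropped SeaProgramme — route-repair (statement-revised p117723: QCDOf gains reg.IsChiralAtZero) — supply the conjunct as an explicit SHARED crux: two-regime re-cut of the programme it (planner-rrepair-QuantumFields-SeaNonGibbs-stmt-d92b31b0-0)
- 2026-08-23T06:25:22Z · DORMANT — reconciler: no traction for 5.9 d (last activity item-evidence-added at 2026-08-17T07:10:04Z); parked, not closed — `ledger route dormant route-QuantumFields-Se (operator:999:3358617)
- 2026-08-28T21:23:09Z · REACTIVATED — reconciler: reactivated — activity statement-closed at 2026-08-28T18:42:51Z after parking at 2026-08-23T06:25:22Z (operator:999:2960476)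
- 2026-09-03T09:42:06Z · DORMANT — reconciler: no traction for 5 d (last activity statement-checked at 2026-08-29T08:46:06Z); parked, not closed — `ledger route dormant route-QuantumFields-SeaNon (operator:999:3910061)

sub-problem: QCD · status: dormant · opened planner-plancard-QuantumFields-QCD-the-sea-is-0e653be0-0 2026-08-15T13:35:25Z · rev 7 · ledger route-QuantumFields-SeaNonGibbs
GENERATED by the gate from the ledger (D-0016/17). Provers cite these decls: `theorem foo : Summit.QuantumFields.QCD.Theses.SeaNonGibbs.<Decl> := …` in Summits/QuantumFields/QCD/Theorems/<Name>.lean.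
-/

namespace Summit.QuantumFields.QCD.Theses.SeaNonGibbs

open scoped BigOperators Topology Manifold Classical MeasureTheory ProbabilityTheory Matrix InnerProductSpace ComplexConjugate ContinuousMap
open Filter Set Function TopologicalSpace MeasureTheory

attribute [summit_statement] _root_.QCD

/-- item stmt-QuantumFields-8854 · crux · rank 2 · open · by planner
why it might fail: Claimed for EVERY limit state at every β ≥ 0: conditional laws of limit states must be limits of torus kernels on positive-measure tuned/detuned events through a μ-typical ROUGH far field — needs a.s. decay of the supercritical Wilson propagator in random links (open) and a Wegner-type bound.
sources: VanenterFernandezSokal1993, Fernandez2000Gibbsianness, BerrutoNarayananNeuberger2000, EdwardsHellerNarayanan1998, Georgii2011, Kulske2003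
[crux] for every N_f ≥ 1, β ≥ 0 and m ∈ (−2, 0): every probability measure μ on `LGConfig 4 SU3`
that is the limit, on bounded continuous cylinder observables, of the periodic lifts of
`qcdLatticeMeasure (L_k+1) β (m,…,m)` along a strictly increasing sequence of torus sides (an
infinite-volume sea state) is NOT a quasilocal measure: it is consistent with no Feller
specification (`Literature.Barriers.CriticalPhenomena.NonGibbs.IsQuasilocalMeasure`, VEFS Def.
2.13/2.14), hence is the Gibbs measure of no continuous absolutely summable potential. Proof shape
(card (b)): essential discontinuity at η* = (rough typical far field) + (one dislocation at distance
L pinning a simple real mode of D_W + m at 0); tuned exteriors give the single-link law ∝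
|δλ(u)|^{N_f} × smooth, detuned ones the smooth law; both classes charge every neighbourhood of η*.
[deps: NonQuasilocalWindow, RealModesFillTheWindow] [difficulty: XL] -/
@[route_item "route-QuantumFields-SeaNonGibbs"]
def NonQuasilocalSeaStates : Prop :=
  open Literature.MathematicalPhysics.QuantumFieldTheory Literature.MathematicalPhysics.QuantumLattice Literature.Probability.LatticeModels in ∀ Nf : ℕ, 1 ≤ Nf → ∀ β : ℝ, 0 ≤ β → ∀ m : ℝ, -2 < m → m < 0 → let w : (n : ℕ) → Measure (GaugeConfig 4 (n + 1) (Matrix.specialUnitaryGroup (Fin 3) ℂ)) := fun n => (wilsonWeight (d := 4) (L := n + 1) (fundamentalRep (Fin 3)) β).withDensity fun U => ENNReal.ofReal (‖fermionDet (wilsonDirac (fundamentalRep (Fin 3)) U m 1)‖ ^ Nf); let sea : (n : ℕ) → Measure (GaugeConfig 4 (n + 1) (Matrix.specialUnitaryGroup (Fin 3) ℂ)) := fun n => (w n Set.univ)⁻¹ • w n; ∀ (μ : Measure (LGConfig 4 (Matrix.specialUnitaryGroup (Fin 3) ℂ))) (Ls : ℕ → ℕ), StrictMono Ls → IsProbabilityMeasure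 μ → (∀ (F : LGConfig 4 (Matrix.specialUnitaryGroup (Fin 3) ℂ) → ℝ) (S : Finset (ZdEdge 4)), IsCylinder F S → Continuous F → (∃ C, ∀ U, |F U| ≤ C) → Tendsto (fun k : ℕ => ∫ U, F (torusLift (Ls k + 1) U) ∂(sea (Ls k))) atTop (𝓝 (∫ U, F U ∂μ))) → ¬ ∃ γ : Specification (ZdEdge 4) (Matrix.specialUnitaryGroup (Fin 3) ℂ), IsSpecification γ ∧ (∀ (Λ : Finset (ZdEdge 4)) (f : BoundedContinuousFunction (LGConfig 4 (Matrix.specialUnitaryGroup (Fin 3) ℂ)) ℝ), Continuous fun η : LGConfig 4 (Matrix.specialUnitaryGroup (Fin 3) ℂ) => ∫ σ, f σ ∂(γ Λ η)) ∧ IsGibbsMeasure γ μ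

/-- item stmt-QuantumFields-8855 · crux · rank 3 · open · by planner
why it might fail: Stated for ALL β ≥ 0, m ∈ (−2,0): in the Aoki phase (strong coupling, flavour-parity order, gapless γ₅D_W) the block-constrained fine sea can sit at coexistence, where one-step block maps are generically non-quasilocal (VEFS Thm 4.2 mechanism); else needs a uniform smearing width of the pinned mode.
sources: VanenterFernandezSokal1993, BricmontKupiainenLefevere1998, MaesRedigVanmoffaert1999, Aoki1984WilsonPhase, SharpeSingleton1998, tree:Literature.Barriers.QuantumFields.AokiPhaseDichotomy
[crux] for every N_f ≥ 1, β ≥ 0, m ∈ (−2, 0) and block size M ≥ 2: the push-forward of every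
infinite-volume sea state (same hypotheses as in NonQuasilocalSeaStates) under Bałaban's axial
block-link map `axialBlockHolonomy M` IS a quasilocal measure (consistent with some Feller
specification). Card (c): integrating the fine fluctuations compatible with the block links smears
the pinned eigenvalue over a width w(V) > 0, so the interior distortion becomes O(e^{−2cL}/w) and
dies with the distance; the design-rule residue (the block potential is quasilocal but NOT sup-small
near mode-pinning block patterns) is recorded in Not decomposed yet. [deps: NonQuasilocalSeaStates]
[difficulty: XL] -/
@[route_item "route-QuantumFields-SeaNonGibbs"]
def QuasilocalAfterBlocking : Prop :=
  open Literature.MathematicalPhysics.QuantumFieldTheory Literature.MathematicalPhysics.QuantumLattice Literature.Probability.LatticeModels in ∀ Nf : ℕ, 1 ≤ Nf → ∀ β : ℝ, 0 ≤ β → ∀ m : ℝ, -2 < m → m < 0 → ∀ M : ℕ, 2 ≤ M → let w : (n : ℕ) → Measure (GaugeConfig 4 (n + 1) (Matrix.specialUnitaryGroup (Fin 3) ℂ)) := fun n => (wilsonWeight (d := 4) (L := n + 1) (fundamentalRep (Fin 3)) β).withDensity fun U => ENNReal.ofReal (‖fermionDet (wilsonDirac (fundamentalRep (Fin 3)) U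 m 1)‖ ^ Nf); let sea : (n : ℕ) → Measure (GaugeConfig 4 (n + 1) (Matrix.specialUnitaryGroup (Fin 3) ℂ)) := fun n => (w n Set.univ)⁻¹ • w n; let block : LGConfig 4 (Matrix.specialUnitaryGroup (Fin 3) ℂ) → LGConfig 4 (Matrix.specialUnitaryGroup (Fin 3) ℂ) := fun U b => ((List.range M).map fun t : ℕ => U ((fun i : Fin 4 => (M : ℤ) * b.1 i) + Pi.single b.2 (t : ℤ), b.2)).prod; ∀ (μ : Measure (LGConfig 4 (Matrix.specialUnitaryGroup (Fin 3) ℂ))) (Ls : ℕ → ℕ), StrictMono Ls → IsProbabilityMeasure μ → (∀ (F : LGConfig 4 (Matrix.specialUnitaryGroup (Fin 3) ℂ) → ℝ) (S : Finset (ZdEdge 4)), IsCylinder F S → Continuous F → (∃ C, ∀ U, |F U| ≤ C) → Tendsto (fun k : ℕ => ∫ U, F (torusLift (Ls k + 1) U) ∂(sea (Ls k))) atTop (𝓝 (∫ U, F U ∂μ))) → ∃ γ : Specification (ZdEdge 4) (Matrix.specialUnitaryGroup (Fin 3) ℂ), IsSpecification γ ∧ (∀ (Λ : Finset (ZdEdge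 4)) (f : BoundedContinuousFunction (LGConfig 4 (Matrix.specialUnitaryGroup (Fin 3) ℂ)) ℝ), Continuous fun η : LGConfig 4 (Matrix.specialUnitaryGroup (Fin 3) ℂ) => ∫ σ, f σ ∂(γ Λ η)) ∧ IsGibbsMeasure γ (μ.map block)

/-- item stmt-QuantumFields-8856 · crux · rank 4 · open · by planner
why it might fail: δ must be uniform in L: the tuned real mode must be SIMPLE (ψ†γ₅ψ ≠ 0, transversal crossing) and the normalised shift profile u ↦ λ_L(u) on the window link must not flatten as L → ∞; defective crossings on every carrier family, or modes blind to far links (BNN exact local modes), force δ_L → 0.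
sources: BerrutoNarayananNeuberger2000, EdwardsHellerNarayanan1998, EdwardsHellerNarayananInstanton1998, VanenterFernandezSokal1993, Neuberger2000, MontvayMunster1994
[crux] (design rule, deterministic, finite volume) for every N_f ≥ 1, every real β and every m ∈
(−2,0) there is δ > 0 such that for every radius L, on all sufficiently large tori (side n+1, n ≥
n₀(L)), there are a link e₀ and two SU(3) gauge fields U, U′ agreeing on every link whose base point
is within ℓ¹ torus distance L of e₀'s (other than e₀) whose conditional single-link laws at e₀ —
densities p(U,e₀,u) = w(U[e₀:=u]) / ∫ w(U[e₀:=v]) dv w.r.t. Haar, w = e^{−βS_W}|det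
D_W(·,m,1)|^{N_f} the `qcdLatticeMeasure` weight, both normalisers positive — are at total-variation
distance ≥ δ. So no version of the sea's conditional probabilities is quasilocal UNIFORMLY in the
volume; equivalently the cutoff sea is not "Yang–Mills + a uniformly convergent quasilocal
potential" for any κ ∈ (1/8, 1/4). Construction: U = free links + one dislocation at distance L+1
tuned (IVT from RealModesFillTheWindow) to a simple real mode of D_W+m at 0 with the zero placed at
the action-minimising u; U′ = the same with the dislocation detuned. [deps: RealModesFillTheWindow]
[difficulty: L] -/
@[route_item "route-QuantumFields-SeaNonGibbs"]
def NonQuasilocalWindow : Prop :=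
  open Literature.MathematicalPhysics.QuantumFieldTheory Literature.MathematicalPhysics.QuantumLattice in ∀ Nf : ℕ, 1 ≤ Nf → ∀ β m : ℝ, -2 < m → m < 0 → ∃ δ : ℝ, 0 < δ ∧ ∀ L : ℕ, ∃ n₀ : ℕ, ∀ n : ℕ, n₀ ≤ n → let w : GaugeConfig 4 (n + 1) (Matrix.specialUnitaryGroup (Fin 3) ℂ) → ℝ := fun U => Real.exp (-β * wilsonAction (fundamentalRep (Fin 3)) U) * ‖fermionDet (wilsonDirac (fundamentalRep (Fin 3)) U m 1)‖ ^ Nf; let Z : GaugeConfig 4 (n + 1) (Matrix.specialUnitaryGroup (Fin 3) ℂ) → Edge 4 (n + 1) → ℝ := fun U e => ∫ v, w (Function.update U e v) ∂(haarProbability (Matrix.specialUnitaryGroup (Fin 3) ℂ)); let p : GaugeConfig 4 (n + 1) (Matrix.specialUnitaryGroup (Fin 3) ℂ) → Edge 4 (n + 1) → Matrix.specialUnitaryGroup (Fin 3) ℂ → ℝ := fun U e u => w (Function.update U e u) / Z U e; ∃ (e₀ : Edge 4 (n + 1)) (U U' : GaugeConfig 4 (n + 1) (Matrix.specialUnitaryGroup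 (Fin 3) ℂ)), (∀ e : Edge 4 (n + 1), (∑ i : Fin 4, ((e.1 i - e₀.1 i).valMinAbs.natAbs)) ≤ L → e ≠ e₀ → U e = U' e) ∧ 0 < Z U e₀ ∧ 0 < Z U' e₀ ∧ δ ≤ ∫ u, |p U e₀ u - p U' e₀ u| ∂(haarProbability (Matrix.specialUnitaryGroup (Fin 3) ℂ))

/-- item stmt-QuantumFields-17629 · crux · rank 6 · open · by planner
why it might fail: QCD-complete; (c) is qualitative (fixed β, m; no rates along β → ∞ / the LCP): needs a DEFECT-robust SU(3) YM gap + OS-limit engine (none even for N_f = 0), κ-tuning inside the non-quasilocal window, signed defects for odd N_f, quark-channel gaps; vacuous if (c) is refuted.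
sources: JaffeWitten2000, Balaban1989LargeFieldII, Balaban1988Convergent, BricmontKupiainenLefevere1998, ScottSokal2005, MontvayMunster1994
[crux] ENGINE ITEM (QCD-complete, flagged; replaces SeaProgramme at the statement re-type p117723):
QuasilocalAfterBlocking → threshold-form QCD — given that one block step turns the Wilson sea into a
quasilocal block potential (quasilocal but NOT sup-small near mode-pinning block patterns: a dilute,
for odd N_f signed, defect layer INSIDE Bałaban's small-field region), a DEFECT-ROBUST SU(3)
Yang–Mills engine (card K3 RobustnessWithDefects) fed with the blocked sea along an asymptotically
scaling scheme, bare masses on the line of constant physics, quark channels inheriting the gap,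
constructs for N_f = 2 and 3 one mass-independent regularisation with leading-log mass scaling and
an offset M₀ ≥ 0 above which every tuple has OS data with IsQCDAlong, non-trivial non-Gaussian glue,
dynamical quarks and one Δ > 0 with T.HasMassGap Δ ∧ HasLatticeMassGap Δ (the body of
HeavyThresholdYMBridge's ThresholdQCD, stmt-QuantumFields-8794, verbatim after the arrow). Weaker
than the dropped SeaProgramme := QuasilocalAfterBlocking → QCD (planner Sketch.lean
`seaThreshold_of_seaProgramme`); with ChiralCompletion it gives it back (`seaProgramme_of_split`).
Not for provers now; foreseen split DefectR -/
@[route_item "route-QuantumFields-SeaNonGibbs"]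
def SeaThreshold : Prop :=
  QuasilocalAfterBlocking → ∀ Nf : ℕ, Nf = 2 ∨ Nf = 3 → ∃ M₀ : ℝ, 0 ≤ M₀ ∧ ∃ reg : Literature.MathematicalPhysics.QuantumFieldTheory.QCDRegularisation Nf, reg.HasMassScaling ∧ ∀ m : Fin Nf → ℝ, (∀ f, M₀ < m f) → ∃ (z shift : Literature.MathematicalPhysics.QuantumFieldTheory.QCDField Nf → ℕ → ℝ) (T : Literature.MathematicalPhysics.QuantumFieldTheory.OSData (Literature.MathematicalPhysics.QuantumFieldTheory.QCDField Nf) 4), Literature.MathematicalPhysics.QuantumFieldTheory.IsQCDAlong (reg.scheme m z shift) T ∧ T.IsNontrivial Literature.MathematicalPhysics.QuantumFieldTheory.QCDField.glue ∧ T.IsNonGaussian Literature.MathematicalPhysics.QuantumFieldTheory.QCDField.glue ∧ (∀ f g : Fin Nf, f ≠ g → T.IsNontrivial (Literature.MathematicalPhysics.QuantumFieldTheory.QCDField.pseudoRe f g)) ∧ ∃ Δ > 0, T.HasMassGap Δ ∧ (reg.scheme m z shift).HasLatticeMassGap Δ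

/-- item stmt-QuantumFields-17394 · crux · rank 7 · open · by planner
why it might fail: Contains light-quark lattice QCD: m_crit(k) tuned to κ_c(β_k) beyond the O(aΛ) ambiguity, UV/IR control of arbitrarily light Wilson quarks (near-real modes of D_W — this route's window; Aoki/first-order dichotomy at fixed a), gaplessness of massless N_f = 2, 3 QCD — no OS-level proof of any.
sources: GellmannOakesRenner1968, GasserLeutwyler1984, tHooft1980Naturalness, SharpeSingleton1998, Aoki1984WilsonPhase, EdwardsHellerNarayanan1998
[crux] the CHIRAL COMPLETION — exactly what the statement re-type p117723 added to the parent bridge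
(and the intended SHARED chiral item of the heavy-threshold family; same text re-askable by
HeavyThresholdYMBridge / HeatSlicedQuarks / NestedDissectionSea …): for N_f ∈ {2,3}, FROM the
threshold form (some M₀ ≥ 0 and a mass-scaling reg₀ with honest data + gap at all tuples above M₀)
CONCLUDE the re-typed QCDOf N_f — ONE mass-scaling regularisation reg whose m_crit(k) is pinned to
the chiral critical line κ_c(β_k) of Wilson fermions (no hidden offset), carrying species
renormalisations, OS data with IsQCDAlong, non-trivial non-Gaussian glue, dynamical quarks and
T.HasMassGap Δ ∧ HasLatticeMassGap Δ at EVERY positive tuple (arbitrarily light quarks), AND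
reg.IsChiralAtZero: for every ε > 0 some positive tuple has no uniform lattice gap ε — the gap
closes as m → 0⁺ (Goldstone pions m_π² ≍ B·m if chiral symmetry breaks, 't Hooft anomaly matching
otherwise). Consumption lemma landed: Cruxes.StableActionBridge.Sketch.isChiralAtZero_of_goldstone
(a connected two-point LOWER bound ≥ c·e^{−μ a_k n_k}, μ < ε, along a_k n_k → ∞ refutes
HasLatticeMassGap ε); obstruction landed: Theorems.Robust -/
@[route_item "route-QuantumFields-SeaNonGibbs"]
def ChiralCompletion : Prop :=
  ∀ Nf : ℕ, Nf = 2 ∨ Nf = 3 → (∃ M₀ : ℝ, 0 ≤ M₀ ∧ ∃ reg : Literature.MathematicalPhysics.QuantumFieldTheory.QCDRegularisation Nf, reg.HasMassScaling ∧ ∀ m : Fin Nf → ℝ, (∀ f, M₀ < m f) → ∃ (z shift : Literature.MathematicalPhysics.QuantumFieldTheory.QCDField Nf → ℕ → ℝ) (T : Literature.MathematicalPhysics.QuantumFieldTheory.OSData (Literature.MathematicalPhysics.QuantumFieldTheory.QCDField Nf) 4), Literature.MathematicalPhysics.QuantumFieldTheory.IsQCDAlong (reg.scheme m z shift) T ∧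 T.IsNontrivial Literature.MathematicalPhysics.QuantumFieldTheory.QCDField.glue ∧ T.IsNonGaussian Literature.MathematicalPhysics.QuantumFieldTheory.QCDField.glue ∧ (∀ f g : Fin Nf, f ≠ g → T.IsNontrivial (Literature.MathematicalPhysics.QuantumFieldTheory.QCDField.pseudoRe f g)) ∧ ∃ Δ > 0, T.HasMassGap Δ ∧ (reg.scheme m z shift).HasLatticeMassGap Δ) → _root_.QCDOf Nf

/-- item stmt-QuantumFields-8857 · support · rank 5 · open · by planner
why it might fail: carriers for −m → 0⁺ must grow (size ≍ |m|^{-1/2}; needs the lattice index theorem for transcripts of smooth charge-1 fields plus location of the crossing), for −m → 2⁻ they are rough dislocations; an odd count below −m could fail on some middle sub-window on every volume.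
sources: Adams2001, arXiv:hep-lat/0009026, Neuberger2000, tree:Literature.Barriers.QuantumFields.WilsonDeterminantSign_holds, Luscher1982Topology, EdwardsHellerNarayananInstanton1998
[crux] quenched zero modes occur throughout the supercritical window: for every m ∈ (−2, 0) there is
n₀ such that on every four-torus of side n+1 ≥ n₀+1 some SU(3) gauge field U has Re det D_W(U, m, 1)
< 0 — by the tree's `WilsonDeterminantSign` an odd spectral index, i.e. an odd number of real
eigenvalues of the Wilson operator below −m; by `WilsonDeterminantMassSplitting`-style IVT along any
path from U = 1 this yields fields with a real mode EXACTLY at −m (the bad configurations of cruxes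
2 and 4). Edwards–Heller–Narayanan's region II made a theorem: carriers are smooth instanton
transcripts for −m → 0⁺ (index theorem at small spacing) and hypercube dislocations for −m → 2⁻
(BNN: U(1) hypercube modes for m < −1.7, SU(2) for m < −1.1). [difficulty: M] -/
@[route_item "route-QuantumFields-SeaNonGibbs"]
def RealModesFillTheWindow : Prop :=
  open Literature.MathematicalPhysics.QuantumFieldTheory Literature.MathematicalPhysics.QuantumLattice in ∀ m : ℝ, -2 < m → m < 0 → ∃ n₀ : ℕ, ∀ n : ℕ, n₀ ≤ n → ∃ U : GaugeConfig 4 (n + 1) (Matrix.specialUnitaryGroup (Fin 3) ℂ), (fermionDet (wilsonDirac (fundamentalRep (Fin 3)) U m 1)).re < 0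

/-- item stmt-QuantumFields-8858 · support · rank 9 · closed · proved by Summit.QuantumFields.QCD.Theorems.seaNonGibbs_uniformLoopPotential_proof (prover) · by planner
sources: SeilerLNP1982, Rothe2005, MontvayMunster1994, Literature.Barriers.QuantumFields.HoppingExpansionLocality
[support] regime (a), κ < 1/8: for every m > 0 and N_f there is C such that for every real β, every
torus, every link e₀, every radius L and every two gauge fields agreeing on the links within ℓ¹
distance L of e₀ (other than e₀), the conditional single-link laws at e₀ (as in NonQuasilocalWindow)
are within C·(4/(m+4))^{2L} in total variation — θ = 4/(m+4) = 8κ. Proof: log|det(1−κM)| ratio =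
log|det₂₄(1 − κ B R_η^{loc})| with R = (1−κM)^{-1}, ‖κM[U]‖₂ ≤ 8κ = θ < 1 (each direction's hop pair
is 2 × a unitary), and ‖P_S(R_η − R_η′)P_S‖ ≤ 2θ·θ^{2L−2}/(1−θ)² by the range-one locality of the
tree's `HoppingExpansionLocality` (`pow_apply_eq_zero_of_lt`, `norm_inv_le`); the plaquette factor
through e₀ cancels for L ≥ 1. [difficulty: provable-now] -/
@[route_item "route-QuantumFields-SeaNonGibbs"]
def UniformLoopPotential : Prop :=
  open Literature.MathematicalPhysics.QuantumFieldTheory Literature.MathematicalPhysics.QuantumLattice in ∀ m : ℝ, 0 < m → ∀ Nf : ℕ, ∃ C : ℝ, ∀ β : ℝ, ∀ n L : ℕ, let w : GaugeConfig 4 (n + 1) (Matrix.specialUnitaryGroup (Fin 3) ℂ) → ℝ := fun U => Real.exp (-β * wilsonAction (fundamentalRep (Fin 3)) U) * ‖fermionDet (wilsonDirac (fundamentalRep (Fin 3)) U m 1)‖ ^ Nf; let Z : GaugeConfig 4 (n + 1) (Matrix.specialUnitaryGroup (Fin 3) ℂ) → Edge 4 (n + 1) → ℝ := fun U e => ∫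 v, w (Function.update U e v) ∂(haarProbability (Matrix.specialUnitaryGroup (Fin 3) ℂ)); let p : GaugeConfig 4 (n + 1) (Matrix.specialUnitaryGroup (Fin 3) ℂ) → Edge 4 (n + 1) → Matrix.specialUnitaryGroup (Fin 3) ℂ → ℝ := fun U e u => w (Function.update U e u) / Z U e; ∀ (e₀ : Edge 4 (n + 1)) (U U' : GaugeConfig 4 (n + 1) (Matrix.specialUnitaryGroup (Fin 3) ℂ)), (∀ e : Edge 4 (n + 1), (∑ i : Fin 4, ((e.1 i - e₀.1 i).valMinAbs.natAbs)) ≤ L → e ≠ e₀ → U e = U' e) → ∫ u, |p U e₀ u - p U' e₀ u| ∂(haarProbability (Matrix.specialUnitaryGroup (Fin 3) ℂ)) ≤ C * (4 / (m + 4)) ^ (2 * L)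

-- `UniformLoopPotential` holds: proved by `Summit.QuantumFields.QCD.Theorems.seaNonGibbs_uniformLoopPotential_proof` (its module imports this route file, so no `_holds` link can be stated here).

/-- item stmt-QuantumFields-8859 · support · rank 9 · closed · proved by Summit.QuantumFields.QCD.Theorems.seaNonGibbs_seaStatesExist_proof (prover) · by planner
sources: Georgii2011, FriedliVelenik2017, OsterwalderSeiler1978
[support] non-vacuity of cruxes 2–3: for every N_f, β, m there are a probability measure μ on
`LGConfig 4 SU3` and a strictly increasing sequence of torus sides along which the periodic lifts of
`qcdLatticeMeasure (L_k+1) β (m,…,m)` converge to μ on bounded continuous cylinder observables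
(compactness of SU(3)^{edges}, diagonal argument over a countable dense family of cylinder
functions; `qcdLatticeMeasure` is a probability measure for every side ≥ 1 since the weight is
continuous, non-negative and not identically zero). [difficulty: provable-now] -/
@[route_item "route-QuantumFields-SeaNonGibbs"]
def SeaStatesExist : Prop :=
  open Literature.MathematicalPhysics.QuantumFieldTheory Literature.MathematicalPhysics.QuantumLattice Literature.Probability.LatticeModels in ∀ Nf : ℕ, ∀ β m : ℝ, let w : (n : ℕ) → Measure (GaugeConfig 4 (n + 1) (Matrix.specialUnitaryGroup (Fin 3) ℂ)) := fun n => (wilsonWeight (d := 4) (L := n + 1) (fundamentalRep (Fin 3)) β).withDensity fun U => ENNReal.ofReal (‖fermionDet (wilsonDirac (fundamentalRep (Fin 3)) U m 1)‖ ^ Nf); let sea : (n : ℕ) → Measure (GaugeConfig 4 (n + 1) (Matrix.specialUnitaryGroup (Fin 3) ℂ)) := fun n => (w n Set.univ)⁻¹ • w n; ∃ (μ : Measure (LGConfig 4 (Matrix.specialUnitaryGroup (Fin 3) ℂ))) (Ls : ℕ → ℕ), StrictMono Ls ∧ IsProbabilityMeasure μ ∧ ∀ (F : LGConfig 4 (Matrix.specialUnitaryGroup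 (Fin 3) ℂ) → ℝ) (S : Finset (ZdEdge 4)), IsCylinder F S → Continuous F → (∃ C, ∀ U, |F U| ≤ C) → Tendsto (fun k : ℕ => ∫ U, F (torusLift (Ls k + 1) U) ∂(sea (Ls k))) atTop (𝓝 (∫ U, F U ∂μ))

-- `SeaStatesExist` holds: proved by `Summit.QuantumFields.QCD.Theorems.seaNonGibbs_seaStatesExist_proof` (its module imports this route file, so no `_holds` link can be stated here).

-- earlier Assembly (stmt-QuantumFields-8860, replaced 2026-08-15T13:51:21Z -> stmt-QuantumFields-9155): retired by None — UniformLoopPotential → RealModesFillTheWindow → NonQuasilocalWindow → NonQuasilocalSeaStates → QuasilocalAfterBlocking → (UniformLoopPotential ∧ RealModesFillTheWindow ∧ NonQuasilocalWindow ∧ NonQuasilocalSeaStates ∧ QuasilocalAfterBlocking)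
-- earlier Assembly (stmt-QuantumFields-9155, replaced 2026-08-16T23:24:20Z -> stmt-QuantumFields-17628): retired by None — QuasilocalAfterBlocking → SeaProgramme → QCD
/-- item stmt-QuantumFields-17628 · assembly · rank 1 · closed · proved by Summit.QuantumFields.QCD.Theorems.seaNonGibbs_assembly_proof (prover) · by planner
sources: VanenterFernandezSokal1993, EdwardsHellerNarayanan1998
[assembly] QuasilocalAfterBlocking → SeaThreshold → ChiralCompletion → QCD (identical to the D-0027
deciding theorem `closes`: `fun hQ hS hC => ⟨hC 2 (Or.inl rfl) (hS hQ 2 (Or.inl rfl)), hC 3 (Or.inr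
rfl) (hS hQ 3 (Or.inr rfl))⟩`; re-cut at the statement re-type p117723, replacing
QuasilocalAfterBlocking → SeaProgramme → QCD). -/
@[route_item "route-QuantumFields-SeaNonGibbs"]
def Assembly : Prop :=
  QuasilocalAfterBlocking → SeaThreshold → ChiralCompletion → QCD

-- `Assembly` holds: proved by `Summit.QuantumFields.QCD.Theorems.seaNonGibbs_assembly_proof` (its module imports this route file, so no `_holds` link can be stated here).

/-! D-0027 §2.1 — DECIDING THEOREM (planner-authored via `route open/edit --closes-file`; by planner-rrepair-QuantumFields-SeaNonGibbs-stmt-d92b31b0-0 2026-08-16T23:24:20Z):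
its hypotheses are this route's items and its conclusion the sub-problem Statement (glue_lint), and it elaborates with this file. -/

@[closes "route-QuantumFields-SeaNonGibbs"] theorem closes : QuasilocalAfterBlocking → SeaThreshold → ChiralCompletion → QCD := fun hQ hS hC => ⟨hC 2 (Or.inl rfl) (hS hQ 2 (Or.inl rfl)), hC 3 (Or.inr rfl) (hS hQ 3 (Or.inr rfl))⟩

end Summit.QuantumFields.QCD.Theses.SeaNonGibbs
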